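import Summits.HodgeConjecture.HodgeConjecture.Theorems.Ring2WeilCoverageCMFieldAllPrimesC
import Mathlib.FieldTheory.Finite.Basic
import Mathlib.Algebra.CharP.Lemmas
import Mathlib.Algebra.CharP.Algebra
import Mathlib.Algebra.Polynomial.SpecificDegree
import HarnessLib

/-!
# Weil-type components over quartic CM fields, IX (part G): the last non-split class of `ℚ(√-(2+√2))` —
# every prime `ℓ ≡ 15 (mod 16)`, by a Frobenius computation in `𝔽_{ℓ²} = 𝔽_ℓ(√-2)`

research route conditional on HC_CM; not a corollary; Q11.4-sentence-2 already refuted in dim ≥ 3. Cell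
`pub-hodge-ring2`, seat `ring2-b03` (gen 51); complement to part C (`Ring2WeilCoverageCMFieldAllPrimesC`). For the
cyclic quartic census field `E = ℚ(√-(2+√2)) ⊂ ℚ(ζ₁₆)` (`R = S² + 4S + 2`, `F = ℚ(√2)`) part C decides `[ℓw] ≠ [1]`
for `ℓ ≡ ±3 (mod 8)` (inert) and `ℓ ≡ 9 (mod 16)` (split in `F`, both places inert in `E/F`; there `√-2 ∈ 𝔽_ℓ` and a
square root of `±√2 - 2` would be a primitive 16th root of unity in `𝔽_ℓ`). The remaining obstructed class
`ℓ ≡ 15 (mod 16)` (census row `[31]`; `47, 79, …`) has `√2 ∈ 𝔽_ℓ` but `√-2 ∉ 𝔽_ℓ`, and the obstruction is a genuinely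
quartic condition; §1 settles it by passing to `K = 𝔽_ℓ[S]/(S² + 2) = 𝔽_{ℓ²}`: if `x² = r - 2` (`r² = 2`) in `𝔽_ℓ`, then
`z = (x² + s)/(2x) ∈ K` (`s² = -2`) satisfies `z⁸ = -1` and, by FROBENIUS (`s^ℓ = -s` by Euler's criterion, `x^ℓ = x`),
`z^ℓ = (x² - s)/(2x)`, so `z^{ℓ+1} = (x⁴ + 2)/(4x²) = -1`; but `16 ∣ ℓ + 1` and `z¹⁶ = 1` give `z^{ℓ+1} = 1` — so
`-1 = 1` in `K`, absurd. Hence (§2) **`[ℓw] ≠ [1]` for every prime `ℓ ≡ 15 (mod 16)`, `ℓ ∤ w`**, and with part C: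
**the component `W8.E.[ℓw]` is NON-SPLIT for EVERY prime `ℓ ≢ ±1 (mod 16)`, `ℓ ≠ 2`** — which is exactly the set of
primes not totally split in `E` (`E` = the fixed field of `{1, 7} ⊂ (ℤ/16)^×`), i.e. the non-split side of this
field's census table is now decided for all primes (the split side, `ℓ ≡ 1, 7 (mod 16)`, stays numeral-by-numeral:
`[7] = [17] = [23] = [1]`, gen 49). No named fact, no definition, no `sorry`; nothing about the Hodge conjecture
is asserted. References: [Deligne1982HodgeCycles] §4 p. 30 (1), Cor. 4.2, Lemma 4.6; [Landherr1936HermitianForms]. -/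

noncomputable section

set_option linter.dupNamespace false

open Polynomial

namespace Summit.HodgeConjecture.HodgeConjecture.Ring2.WeilCoverageCM

open Literature.AlgebraicGeometry.Deligne1982
open Literature.AlgebraicGeometry.HodgeTheory (splitDiscriminantClassCM)

/-! ### §1 No square root of `√2 - 2` in `𝔽_ℓ` for `ℓ ≡ 15 (mod 16)` (Frobenius in `𝔽_ℓ(√-2)`) -/

section Frobenius

variable {ℓ : ℕ} [hℓ : Fact ℓ.Prime]

/-- The algebra in any field of characteristic `≠ 2`: from `r² = 2`, `s² = -2`, `x² = r - 2`, `x ≠ 0`, the element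
`z = (x² + s)/(2x)` has `z⁸ = -1` and `z · (x² - s)/(2x) = -1`. [folklore] -/
theorem pow_eight_eq_neg_one_of_sqrt_data {K : Type*} [Field K] (h2 : (2 : K) ≠ 0) (r s x : K)
    (hr : r ^ 2 = 2) (hs : s ^ 2 = -2) (hx : x ^ 2 = r - 2) (hx0 : x ≠ 0) :
    ((x ^ 2 + s) / (2 * x)) ^ 8 = -1 ∧ ((x ^ 2 + s) / (2 * x)) * ((x ^ 2 - s) / (2 * x)) = -1 := by
  set z : K := (x ^ 2 + s) / (2 * x) with hz
  have h2z : 2 * x * z = x ^ 2 + s := by rw [hz]; field_simp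
  have hz2 : 2 * z ^ 2 = r + s := by
    have h : (2 * x * z) ^ 2 = (x ^ 2 + s) ^ 2 := by rw [h2z]
    have h' : 2 * x ^ 2 * (2 * z ^ 2 - (r + s)) = 0 := by
      linear_combination h + (x ^ 2 - r - 2) * hx - hr + hs
    have hx2 : 2 * x ^ 2 ≠ 0 := mul_ne_zero h2 (pow_ne_zero 2 hx0)
    exact sub_eq_zero.1 ((mul_eq_zero.1 h').resolve_left hx2)
  have hz4 : 2 * z ^ 4 = r * s := by
    have h : (2 * z ^ 2) ^ 2 = (r + s) ^ 2 := by rw [hz2]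
    have h' : (2 : K) * (2 * z ^ 4 - r * s) = 0 := by linear_combination h + hr + hs
    exact sub_eq_zero.1 ((mul_eq_zero.1 h').resolve_left h2)
  have h4 : (4 : K) ≠ 0 := by rw [show (4 : K) = 2 * 2 by norm_num]; exact mul_ne_zero h2 h2
  refine ⟨?_, ?_⟩
  · have h : (2 * z ^ 4) ^ 2 = (r * s) ^ 2 := by rw [hz4]
    have h' : (4 : K) * (z ^ 8 + 1) = 0 := by linear_combination h + s ^ 2 * hr + 2 * hs
    exact eq_neg_of_add_eq_zero_left ((mul_eq_zero.1 h').resolve_left h4)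
  · rw [hz]
    field_simp
    linear_combination (x ^ 2 + r + 2) * hx + hr - hs

/-- **`x² = √2 - 2` has no solution in `𝔽_ℓ` for a prime `ℓ ≡ 15 (mod 16)`.** In `K = 𝔽_ℓ[S]/(S² + 2)` (a field:
`-2` is a non-square mod `ℓ ≡ 7 (mod 8)`), `z = (x² + s)/(2x)` has `z⁸ = -1`, so `z^{ℓ+1} = (z¹⁶)^{(ℓ+1)/16} = 1`;
but Frobenius gives `z^ℓ = (x² - s)/(2x)` (`x, r ∈ 𝔽_ℓ` are fixed, `s^ℓ = (-2)^{(ℓ-1)/2}s = -s` by Euler's criterion),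
whence `z^{ℓ+1} = -1`: contradiction in characteristic `≠ 2`. (In `ℚ(ζ₁₆)`: `ζ₁₆ = (η² + √-2)/(2η)` with
`η = ζ₁₆ - ζ₁₆⁻¹`, `η² = √2 - 2`; a prime `ℓ ≡ 15 (mod 16)` has residue degree `2` in `E = ℚ(η)`.) [folklore] -/
theorem no_sq_eq_sqrt_two_sub_two_of_mod_sixteen (h16 : ℓ % 16 = 15) (r x : ZMod ℓ) (hr : r ^ 2 = 2)
    (hx : x ^ 2 = r - 2) : False := by
  have h2 : ℓ ≠ 2 := by omega
  have h2' : (2 : ZMod ℓ) ≠ 0 := by exact_mod_cast natCast_prime_ne_zero_zmod Nat.prime_two h2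
  have hx0 : x ≠ 0 := by
    intro h0
    rw [h0] at hx
    have hr2 : r = 2 := by linear_combination -hx
    rw [hr2] at hr
    exact h2' (by linear_combination hr)
  have hns : ¬ IsSquare (-2 : ZMod ℓ) := by rw [ZMod.exists_sq_eq_neg_two_iff h2]; omega
  -- the coefficient `a = 2` is kept opaque so that no numeral occurs in the type `K = 𝔽_ℓ[S]/(S² + a)`
  obtain ⟨a, ha⟩ : ∃ a : ZMod ℓ, a = 2 := ⟨2, rfl⟩
  have hmonic : (X ^ 2 + C a).Monic := by monicity!
  have hdeg : (X ^ 2 + C a).natDegree = 2 := by compute_degree!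
  have hirr : Irreducible (X ^ 2 + C a) := by
    rw [hmonic.irreducible_iff_roots_eq_zero_of_degree_le_three (by rw [hdeg]) (by rw [hdeg]; norm_num),
      Multiset.eq_zero_iff_forall_notMem]
    intro t ht
    rw [mem_roots hmonic.ne_zero, IsRoot, eval_add, eval_pow, eval_X, eval_C] at ht
    have ht' : t ^ 2 + 2 = 0 := by rw [← ha]; exact ht
    exact hns ⟨t, by linear_combination -ht'⟩
  haveI : Fact (Irreducible (X ^ 2 + C a)) := ⟨hirr⟩
  haveI : CharP (AdjoinRoot (X ^ 2 + C a)) ℓ :=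
    charP_of_injective_algebraMap (algebraMap (ZMod ℓ) (AdjoinRoot (X ^ 2 + C a))).injective ℓ
  set ι := AdjoinRoot.of (X ^ 2 + C a) with hι
  set s := AdjoinRoot.root (X ^ 2 + C a) with hsdef
  have hιa : ι a = 2 := (congrArg ι ha).trans (map_ofNat ι 2)
  have hs : s ^ 2 = -2 := by
    have h := AdjoinRoot.eval₂_root (X ^ 2 + C a)
    rw [eval₂_add, eval₂_X_pow, eval₂_C] at h
    rw [← hιa]
    linear_combination h
  have h2K : (2 : AdjoinRoot (X ^ 2 + C a)) ≠ 0 := by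
    intro h
    apply h2'
    apply ι.injective
    rw [map_zero, ← h]
    exact map_ofNat ι 2
  have hrK : (ι r) ^ 2 = 2 := by rw [← map_pow, hr]; exact map_ofNat ι 2
  have hxK : (ι x) ^ 2 = ι r - 2 := by rw [← map_pow, hx, map_sub]; exact congrArg _ (map_ofNat ι 2)
  have hxK0 : ι x ≠ 0 := (map_ne_zero_iff ι ι.injective).2 hx0
  obtain ⟨hz8, hzz⟩ := pow_eight_eq_neg_one_of_sqrt_data h2K (ι r) s (ι x) hrK hs hxK hxK0
  set z := ((ι x) ^ 2 + s) / (2 * ι x) with hz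
  -- Frobenius: `s^ℓ = -s`, `(ι t)^ℓ = ι t`
  have hodd : ℓ = 2 * (ℓ / 2) + 1 := by omega
  have heul : (-2 : ZMod ℓ) ^ (ℓ / 2) = -1 := by
    have hne : (-2 : ZMod ℓ) ≠ 0 := neg_ne_zero.2 h2'
    exact (ZMod.pow_div_two_eq_neg_one_or_one ℓ hne).resolve_left
      (fun h => hns ((ZMod.euler_criterion ℓ hne).2 h))
  have hneg2 : (-2 : AdjoinRoot (X ^ 2 + C a)) = ι (-2) := by
    rw [map_neg]; exact congrArg Neg.neg (map_ofNat ι 2).symm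
  have hsℓ : s ^ ℓ = -s := by
    have h1 : (s ^ 2) ^ (ℓ / 2) * s = s ^ ℓ := by rw [← pow_mul, ← pow_succ, ← hodd]
    rw [← h1, hs, hneg2, ← map_pow, heul, map_neg, map_one]
    ring
  have hfix : ∀ t : ZMod ℓ, (ι t) ^ ℓ = ι t := fun t => by rw [← map_pow, ZMod.pow_card]
  have h2ℓ : (2 : AdjoinRoot (X ^ 2 + C a)) ^ ℓ = 2 := by
    have h := hfix 2
    have e : ι 2 = 2 := map_ofNat ι 2
    rw [e] at h
    exact h
  have hzℓ : z ^ ℓ = ((ι x) ^ 2 - s) / (2 * ι x) := by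
    rw [hz, div_pow, add_pow_char, mul_pow, ← pow_mul, mul_comm 2 ℓ, pow_mul, hfix, hsℓ, h2ℓ]
    ring
  -- `z^{ℓ+1} = -1` and `= 1`
  have hneg : z ^ (ℓ + 1) = -1 := by rw [pow_succ' z ℓ, hzℓ]; exact hzz
  have hpos : z ^ (ℓ + 1) = 1 := by
    obtain ⟨m, hm⟩ : ∃ m, ℓ + 1 = 16 * m := ⟨(ℓ + 1) / 16, by omega⟩
    have h16z : z ^ 16 = 1 := by
      rw [show (16 : ℕ) = 8 * 2 by norm_num, pow_mul, hz8]; norm_num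
    rw [hm, pow_mul, h16z, one_pow]
  have hcontra : (-1 : AdjoinRoot (X ^ 2 + C a)) = 1 := hneg.symm.trans hpos
  exact h2K (by linear_combination -hcontra)

end Frobenius

/-! ### §2 `E = ℚ(√-(2+√2))`: every prime `ℓ ≡ 15 (mod 16)`; hence every prime `ℓ ≢ ±1 (mod 16)`, `ℓ ≠ 2` -/

section SqrtNegTwoPlusSqrtTwo

variable {R : Polynomial ℤ} (hR : R = X ^ 2 + C 4 * X + C 2) [Fact (Irreducible (realPolyQ R))]
include hR

/-- **`[ℓw] ≠ [1]` for `E = ℚ(√-(2+√2))` and EVERY prime `ℓ ≡ 15 (mod 16)`, `ℓ ∤ w`**: `ℓ` SPLITS in `F = ℚ(√2)`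
(`2 = r²`; places `σ ↦ ±r - 2`) and both places are INERT in `E/F` by §1 (applied to `r` and `-r`): the split
criterion gives NON-SPLIT components `W8.E.[ℓw]` (census row `[31]`; `47, 79, 127, …`).
[cite: Deligne1982HodgeCycles, §4 p. 30 (1) and Cor. 4.2] [cite: Landherr1936HermitianForms] -/
theorem sqrtNegTwoPlusSqrtTwo_mk_prime_mul_ne_splitDiscriminantClassCM_of_mod_sixteen_fifteen (ℓ : ℕ)
    (hℓ : ℓ.Prime) (h16 : ℓ % 16 = 15) (w : ℤ) (hw : ¬ (ℓ : ℤ) ∣ w) (u : (realField R)ˣ)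
    (hu : (u : realField R) = AdjoinRoot.of (realPolyQ R) (ℓ * w)) :
    (QuotientGroup.mk u : cmNormResidueGroup R) ≠ splitDiscriminantClassCM R 2 := by
  haveI : Fact ℓ.Prime := ⟨hℓ⟩
  have h2 : ℓ ≠ 2 := by omega
  have h2' : (2 : ZMod ℓ) ≠ 0 := by exact_mod_cast natCast_prime_ne_zero_zmod Nat.prime_two h2
  obtain ⟨r, hr⟩ := (ZMod.exists_sq_eq_two_iff h2).2 (Or.inr (by omega))
  have hr' : r ^ 2 = 2 := by rw [sq, ← hr]
  have hr'' : (-r) ^ 2 = 2 := by rw [neg_sq, hr']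
  have hno : ∀ t : ZMod ℓ, t ^ 2 = 2 → ∀ x : ZMod ℓ, x ^ 2 ≠ -2 + t := fun t ht x hx =>
    no_sq_eq_sqrt_two_sub_two_of_mod_sixteen h16 t x ht (by rw [hx]; ring)
  refine mk_prime_mul_ne_splitDiscriminantClassCM_of_two_roots hR (by norm_num) (by norm_num) disc_not_sq_four_two
    ℓ hℓ (-2 + r) (-2 + -r) (by push_cast; linear_combination hr') (by push_cast; linear_combination hr') ?_
    (hno r hr') (hno (-r) hr'') w hw u hu
  intro h
  have hr0 : r = 0 := eq_zero_of_const_mul_eq_zero h2' (by linear_combination h)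
  rw [hr0, mul_zero] at hr
  exact h2' hr

/-- **`[ℓw] ≠ [1]` for `E = ℚ(√-(2+√2))` and EVERY prime `ℓ ≢ ±1 (mod 16)`, `ℓ ≠ 2`, `ℓ ∤ w`** — all primes not totally
split in `E` (inert: `ℓ ≡ ±3 (mod 8)`, part C; split in `F` with both places inert in `E/F`: `ℓ ≡ 9 (mod 16)`, part C,
and `ℓ ≡ 15 (mod 16)`, §1): the NON-SPLIT side of this field's census table, for all primes. (Split side known by
numerals only: `[2] = [7] = [17] = [23] = [1]`, gen 49.) [cite: Deligne1982HodgeCycles, §4 p. 30 (1) and Cor. 4.2]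
[cite: Landherr1936HermitianForms] -/
theorem sqrtNegTwoPlusSqrtTwo_mk_prime_mul_ne_splitDiscriminantClassCM_of_mod_sixteen_ne (ℓ : ℕ) (hℓ : ℓ.Prime)
    (h2 : ℓ ≠ 2) (h16 : ℓ % 16 ≠ 1) (h16' : ℓ % 16 ≠ 7) (w : ℤ) (hw : ¬ (ℓ : ℤ) ∣ w) (u : (realField R)ˣ)
    (hu : (u : realField R) = AdjoinRoot.of (realPolyQ R) (ℓ * w)) :
    (QuotientGroup.mk u : cmNormResidueGroup R) ≠ splitDiscriminantClassCM R 2 := by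
  have hodd : ¬ 2 ∣ ℓ := fun h => by
    rcases (Nat.dvd_prime hℓ).1 h with h | h <;> omega
  have hcases : (ℓ % 8 = 3 ∨ ℓ % 8 = 5) ∨ ℓ % 16 = 9 ∨ ℓ % 16 = 15 := by omega
  rcases hcases with h | h | h
  · exact sqrtNegTwoPlusSqrtTwo_mk_prime_mul_ne_splitDiscriminantClassCM_of_mod_eight hR ℓ hℓ h w hw u hu
  · exact sqrtNegTwoPlusSqrtTwo_mk_prime_mul_ne_splitDiscriminantClassCM_of_mod_sixteen hR ℓ hℓ h w hw u hu
  · exact sqrtNegTwoPlusSqrtTwo_mk_prime_mul_ne_splitDiscriminantClassCM_of_mod_sixteen_fifteen hR ℓ hℓ h w hw u hu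

/-- **`[ℓ] ≠ [1]` for `E = ℚ(√-(2+√2))` and every prime `ℓ ≢ ±1 (mod 16)`, `ℓ ≠ 2`.**
[cite: Deligne1982HodgeCycles, §4 p. 30 (1) and Cor. 4.2] -/
theorem sqrtNegTwoPlusSqrtTwo_mk_prime_ne_splitDiscriminantClassCM_of_mod_sixteen_ne (ℓ : ℕ) (hℓ : ℓ.Prime)
    (h2 : ℓ ≠ 2) (h16 : ℓ % 16 ≠ 1) (h16' : ℓ % 16 ≠ 7) (u : (realField R)ˣ) (hu : (u : realField R) = ℓ) :
    (QuotientGroup.mk u : cmNormResidueGroup R) ≠ splitDiscriminantClassCM R 2 :=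
  sqrtNegTwoPlusSqrtTwo_mk_prime_mul_ne_splitDiscriminantClassCM_of_mod_sixteen_ne hR ℓ hℓ h2 h16 h16' 1
    (by exact_mod_cast hℓ.not_dvd_one) u
    (by rw [hu, Int.cast_one, mul_one]; exact (map_natCast (AdjoinRoot.of (realPolyQ R)) ℓ).symm)

end SqrtNegTwoPlusSqrtTwo

end Summit.HodgeConjecture.HodgeConjecture.Ring2.WeilCoverageCM

end
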